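import Literature.Analysis.FluidPDE.AncientL3BackwardLiouvilleProofs
import Literature.Analysis.FluidPDE.WeakL3LocalEnergyLimit
import Literature.Analysis.FluidPDE.LocalLerayBackwardUniquenessAnyDatum
import Literature.Analysis.FluidPDE.LocalLerayUniformTopBound
import HarnessLib

/-!
# Albritton–Barker 2019, Theorem 4.1 (weak-`L³` backward Liouville): the assembly from the
# local energy class of the blow-down solutions and their uniform initial layer

Analysis/FluidPDE proof file (theorems only: no definition, no named fact, no `sorry`) on the
discharge path of the named fact
`Literature.Analysis.FluidPDE.AlbrittonBarker2019_liouville_weakL3_backward`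
(`AncientL3BackwardLiouville.lean`; Albritton–Barker, J. Math. Fluid Mech. 21 (2019) no. 43 =
arXiv:1811.00502, **Thm. 4.1**, proof on arXiv p. 9). The reduction
`AlbrittonBarker2019_liouville_weakL3_backward_of_blowdown` (`AncientL3BackwardLiouvilleProofs.lean`)
left the blow-down bound `𝔹`: a sequence of bounded continuous mild solutions on `[0, S] × ℝ³`
with weak-`L³` data of size `≤ M` and final slices tending to `0` in `𝒟'` is uniformly bounded
near `(S, 0)` along a subsequence. This file proves `𝔹` — and hence the fact — from the two
analytic properties of such mild solutions that the source takes from Barker–Seregin–Šverák 2018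
(arXiv:1603.03211: Def. 1.1 and §3, "global weak `L^{3,∞}`-solutions"), written out as explicit
hypotheses:

* `hLE` — a bounded continuous mild solution on `[0, S]` with weak-`L³` datum is, for some
  pressure, a local energy solution on `ℝ³ × (0, S)` in Seregin's class
  (`IsLocalEnergySolutionOn`; BSS Def. 1.1 with Remark 3.1/Prop. 3.2 of Albritton–Barker, ARMA
  2019 = arXiv:1802.03164, for the energy class of `u − e^{tΔ}u₀`);
* `hLayer` — the uniform initial layer: `‖u(t) − e^{tΔ}u(0)‖_{L²(B(x₀,1))} ≤ η_M(t) → 0` with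
  `η_M` depending only on the weak-`L³` size `M` of the datum (BSS Lemma 3.4:
  `‖u(t) − e^{tΔ}u₀‖₂² ≤ C(M) t^{1/2}`).

Given these, the proof of Thm. 4.1 runs in the tree as follows
(`blowdown_bound_of_localEnergy_of_layer`): the limiting procedure
`exists_limit_localEnergySolution_weakL3` (`WeakL3LocalEnergyLimit.lean`; Seregin 2014 Ch. 7,
the weak-`L³` datum handled by `WeakL3DataWeakCompactness.lean`) extracts a limit local energy
solution `(u, p)` on `(0, S)`, weak limit at every time, so that `u(S) = 0` weakly ("(4.4)");
backward uniqueness and unique continuation for local Leray solutions with an arbitrary datum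
(`IsLocalLeraySolutionOn.ae_zero_of_final_vanishing_unit_anyDatum`, AB2019 Thm. 3.1 with the far
field of `LocalLerayBackwardUniquenessAnyDatum.lean`) give `u ≡ 0` on `(0, S)` ("Hence `v ≡ 0`");
the strong local convergence `v^{(k)} → 0` in `L²` and the stability of regular points
(`uniform_top_bound_of_bounded_limit_unit`, CKN ε-regularity at one scale, "(4.3) … remains
bounded") bound the approximants a.e. on a parabolic cylinder at `(S, 0)`, eventually in `k`;
continuity makes the bound pointwise.

* `eWeakLpPow_three_le_of_forall`, `memWeakLp_three_of_forall` — the weak-`L³` size in the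
  fact's distribution-function form;
* `norm_le_of_ae_le_of_continuousOn` — an a.e. bound of a continuous field on an open set is a
  pointwise bound;
* `blowdown_bound_of_localEnergy_of_layer` — hypothesis `H` of `…_of_blowdown` from `hLE`,
  `hLayer`;
* `AlbrittonBarker2019_liouville_weakL3_backward_of_localEnergy_of_layer` — the fact from `hLE`,
  `hLayer`.

## References

* D. Albritton, T. Barker, arXiv:1811.00502, Thm. 4.1 and its proof (p. 9), Thm. 3.1.
  [`AlbrittonBarker2019`]
* T. Barker, G. Seregin, V. Šverák, arXiv:1603.03211, Def. 1.1, Thm. 1.3, Lemma 3.4.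
  [`BarkerSeregin2016`]
* G. Seregin, *Lecture Notes on Regularity Theory for the Navier–Stokes Equations* (2014),
  Ch. 7 §7.3, App. B. [`Seregin2014`]
* L. Caffarelli, R. Kohn, L. Nirenberg, Comm. Pure Appl. Math. 35 (1982), Prop. 1. [`CKN1982`]
-/

noncomputable section

open MeasureTheory Set Function Filter Metric TopologicalSpace
open _root_.Topology
open scoped NNReal ENNReal RealInnerProductSpace

namespace Literature.Analysis.FluidPDE

/-! ### The weak-`L³` size in distribution-function form -/

/-- `sup_{t>0} t³ |{|f| > t}| ≤ M` from the bound at every real height `σ > 0` (the height `0`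
contributes `0`). [folklore] -/
theorem eWeakLpPow_three_le_of_forall {f : EuclideanSpace ℝ (Fin 3) → EuclideanSpace ℝ (Fin 3)}
    {M : ℝ≥0∞}
    (h : ∀ σ : ℝ, 0 < σ → ENNReal.ofReal σ ^ 3 *
      volume {x : EuclideanSpace ℝ (Fin 3) | σ < ‖f x‖} ≤ M) :
    FunctionSpaces.eWeakLpPow f 3 volume ≤ M := by
  unfold FunctionSpaces.eWeakLpPow
  refine iSup_le fun t => ?_
  rcases eq_or_ne t 0 with rfl | ht
  · rw [ENNReal.coe_zero, ENNReal.toReal_ofNat, ENNReal.zero_rpow_of_pos (by norm_num), zero_mul]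
    exact zero_le
  have htpos : (0 : ℝ) < t := lt_of_le_of_ne t.coe_nonneg (fun h0 => ht (by exact_mod_cast h0.symm))
  have e1 : ((t : ℝ≥0∞)) ^ (3 : ℝ≥0∞).toReal = ENNReal.ofReal (t : ℝ) ^ 3 := by
    rw [ENNReal.toReal_ofNat, show ((3 : ℝ)) = ((3 : ℕ) : ℝ) by norm_num, ENNReal.rpow_natCast,
      ENNReal.ofReal_coe_nnreal]
  have e2 : {x : EuclideanSpace ℝ (Fin 3) | (t : ℝ≥0∞) < ‖f x‖ₑ} =
      {x : EuclideanSpace ℝ (Fin 3) | (t : ℝ) < ‖f x‖} := by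
    ext x
    simp only [mem_setOf_eq]
    rw [← ofReal_norm, ← ENNReal.ofReal_coe_nnreal, ENNReal.ofReal_lt_ofReal_iff_of_nonneg t.coe_nonneg]
  rw [e1, e2]
  exact h t htpos

/-- A measurable field with `sup_{σ>0} σ³ |{|f| > σ}| ≤ M < ∞` is a weak-`L³` field. [folklore] -/
theorem memWeakLp_three_of_forall {f : EuclideanSpace ℝ (Fin 3) → EuclideanSpace ℝ (Fin 3)}
    (hf : AEStronglyMeasurable f volume) {M : ℝ≥0∞} (hM : M < ∞)
    (h : ∀ σ : ℝ, 0 < σ → ENNReal.ofReal σ ^ 3 *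
      volume {x : EuclideanSpace ℝ (Fin 3) | σ < ‖f x‖} ≤ M) :
    FunctionSpaces.MemWeakLp f 3 volume :=
  ⟨hf, lt_of_le_of_lt (eWeakLpPow_three_le_of_forall h) hM⟩

/-! ### A.e. bounds of continuous fields -/

/-- **An a.e. bound of a continuous field on an open set holds everywhere on it** (the
exceptional set is open and null, hence empty: Lebesgue measure charges open sets). [folklore] -/
theorem norm_le_of_ae_le_of_continuousOn {F : Type*} [NormedAddCommGroup F]
    {f : ℝ × EuclideanSpace ℝ (Fin 3) → F} {U : Set (ℝ × EuclideanSpace ℝ (Fin 3))}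
    (hU : IsOpen U) (hf : ContinuousOn f U) {K : ℝ}
    (h : ∀ᵐ z ∂(volume.restrict U), ‖f z‖ ≤ K) : ∀ z ∈ U, ‖f z‖ ≤ K := by
  intro z hz
  by_contra hlt
  push Not at hlt
  -- the open set where the bound fails
  obtain ⟨O, hO, hOf⟩ := (_root_.continuousOn_iff'.1 (continuous_norm.comp_continuousOn hf)) (Ioi K) isOpen_Ioi
  have hzO : z ∈ O ∩ U := by
    rw [← hOf]; exact ⟨hlt, hz⟩
  have hpos : 0 < volume (O ∩ U) := (hO.inter hU).measure_pos volume ⟨z, hzO⟩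
  have hnull : volume.restrict U {w | ¬‖f w‖ ≤ K} = 0 := ae_iff.1 h
  rw [Measure.restrict_apply' hU.measurableSet] at hnull
  have hsub : O ∩ U ⊆ {w | ¬‖f w‖ ≤ K} ∩ U := by
    intro w hw
    have hw' : w ∈ ((fun a => ‖a‖) ∘ f) ⁻¹' Ioi K ∩ U := by rw [hOf]; exact hw
    exact ⟨not_le.2 hw'.1, hw.2⟩
  exact absurd (measure_mono_null hsub hnull) hpos.ne'

/-! ### The blow-down bound from the local energy class and the uniform layer -/

/-- **The blow-down bound `𝔹`** (hypothesis `H` of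
`AlbrittonBarker2019_liouville_weakL3_backward_of_blowdown`) **from the local energy class of
bounded mild solutions with weak-`L³` data (`hLE`) and their uniform initial layer (`hLayer`)**:
Albritton–Barker 2019, proof of Thm. 4.1 — limiting procedure
(`exists_limit_localEnergySolution_weakL3`), `u(S) = 0` weakly, backward uniqueness for local
Leray solutions (`IsLocalLeraySolutionOn.ae_zero_of_final_vanishing_unit_anyDatum`), strong local
convergence to `0` and stability of regular points (`uniform_top_bound_of_bounded_limit_unit`),
continuity. [cite: AlbrittonBarker2019, Thm 4.1, proof (arXiv:1811.00502 §4 p. 9)] -/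
theorem blowdown_bound_of_localEnergy_of_layer
    (hLE : ∀ (S : ℝ), 0 < S →
      ∀ u : ℝ → EuclideanSpace ℝ (Fin 3) → EuclideanSpace ℝ (Fin 3),
        ContinuousOn (uncurry u) (Icc 0 S ×ˢ univ) →
        (∃ C : ℝ, ∀ t ∈ Icc 0 S, ∀ x, ‖u t x‖ ≤ C) →
        (∀ t ∈ Icc 0 S, IsWeaklyDivFree (u t)) →
        (∀ s t : ℝ, 0 ≤ s → s < t → t ≤ S → ∀ x,
          u t x = UnboundedOperators.heatExtension (u s) (t - s) x - oseenDuhamel 1 s u u t x) →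
        FunctionSpaces.MemWeakLp (u 0) 3 volume →
        ∃ π : ℝ → EuclideanSpace ℝ (Fin 3) → ℝ, IsLocalEnergySolutionOn S 1 (u 0) u π)
    (hLayer : ∀ M : ℝ≥0, ∃ η : ℝ → ℝ≥0, Tendsto η (𝓝[>] 0) (𝓝 0) ∧
      ∀ (S : ℝ), 0 < S → S ≤ 1 →
      ∀ u : ℝ → EuclideanSpace ℝ (Fin 3) → EuclideanSpace ℝ (Fin 3),
        ContinuousOn (uncurry u) (Icc 0 S ×ˢ univ) →
        (∃ C : ℝ, ∀ t ∈ Icc 0 S, ∀ x, ‖u t x‖ ≤ C) →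
        (∀ t ∈ Icc 0 S, IsWeaklyDivFree (u t)) →
        (∀ s t : ℝ, 0 ≤ s → s < t → t ≤ S → ∀ x,
          u t x = UnboundedOperators.heatExtension (u s) (t - s) x - oseenDuhamel 1 s u u t x) →
        FunctionSpaces.eWeakLpPow (u 0) 3 volume ≤ M →
        ∀ t ∈ Ioo 0 S, ∀ x₀ : EuclideanSpace ℝ (Fin 3),
          eLpNorm (u t - heatTest 1 (u 0) t) 2 (volume.restrict (ball x₀ 1)) ≤ η t)
    (M : ℝ≥0∞) (hM : M < ∞) :
    ∃ S : ℝ, 0 < S ∧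
      ∀ u : ℕ → ℝ → EuclideanSpace ℝ (Fin 3) → EuclideanSpace ℝ (Fin 3),
        (∀ k, ContinuousOn (uncurry (u k)) (Icc 0 S ×ˢ univ)) →
        (∀ k, ∃ C : ℝ, ∀ t ∈ Icc 0 S, ∀ x, ‖u k t x‖ ≤ C) →
        (∀ k, ∀ t ∈ Icc 0 S, IsWeaklyDivFree (u k t)) →
        (∀ k (s t : ℝ), 0 ≤ s → s < t → t ≤ S → ∀ x,
          u k t x = UnboundedOperators.heatExtension (u k s) (t - s) x -
            oseenDuhamel 1 s (u k) (u k) t x) →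
        (∀ k (σ : ℝ), 0 < σ →
          ENNReal.ofReal σ ^ 3 * volume {x : EuclideanSpace ℝ (Fin 3) | σ < ‖u k 0 x‖} ≤ M) →
        (∀ φ : EuclideanSpace ℝ (Fin 3) → EuclideanSpace ℝ (Fin 3),
          FunctionSpaces.IsTestFunctionOn (⊤ : Opens (EuclideanSpace ℝ (Fin 3))) φ →
            Tendsto (fun k => ∫ x, ⟪u k S x, φ x⟫) atTop (𝓝 0)) →
        ∃ (φ : ℕ → ℕ) (ρ K : ℝ), StrictMono φ ∧ 0 < ρ ∧
          ∀ j, ∀ s ∈ Ioo (S - ρ ^ 2) S, ∀ y ∈ ball (0 : EuclideanSpace ℝ (Fin 3)) ρ,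
            ‖u (φ j) s y‖ ≤ K := by
  -- ### the constants: `M' = M` as a finite number, the time `S = σ₀(M')`, the layer `η_{M'}`
  set M' : ℝ≥0 := M.toNNReal with hM'
  have hMM' : M = (M' : ℝ≥0∞) := (ENNReal.coe_toNNReal hM.ne).symm
  obtain ⟨σ₀, hσ₀, hσ₀1, hN4⟩ := exists_limit_localEnergySolution_weakL3 M'
  obtain ⟨η, hη, hL⟩ := hLayer M'
  refine ⟨σ₀, hσ₀, fun u hcont hbdd hdiv hmild hW hfinal => ?_⟩
  -- ### the data are weak-`L³` fields of size `≤ M'`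
  have hu0c : ∀ k, Continuous (u k 0) := fun k =>
    (hcont k).comp_continuous (f := fun x : EuclideanSpace ℝ (Fin 3) => ((0 : ℝ), x))
      (by fun_prop) fun x => ⟨⟨le_rfl, hσ₀.le⟩, mem_univ _⟩
  have hWM : ∀ k, FunctionSpaces.eWeakLpPow (u k 0) 3 volume ≤ M' := fun k =>
    eWeakLpPow_three_le_of_forall fun σ hσ => (hW k σ hσ).trans hMM'.le
  have ha : ∀ k, FunctionSpaces.MemWeakLp (u k 0) 3 volume := fun k =>
    ⟨(hu0c k).aestronglyMeasurable, lt_of_le_of_lt (hWM k) ENNReal.coe_lt_top⟩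
  -- ### the approximants are local energy solutions with the uniform layer
  have hLEk : ∀ k, ∃ π : ℝ → EuclideanSpace ℝ (Fin 3) → ℝ,
      IsLocalEnergySolutionOn σ₀ 1 (u k 0) (u k) π := fun k =>
    hLE σ₀ hσ₀ (u k) (hcont k) (hbdd k) (hdiv k) (hmild k) (ha k)
  choose π hπ using hLEk
  have hlay : ∀ k, ∀ t ∈ Ioo 0 σ₀, ∀ x₀ : EuclideanSpace ℝ (Fin 3),
      eLpNorm (u k t - heatTest 1 (u k 0) t) 2 (volume.restrict (ball x₀ 1)) ≤ η t := fun k =>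
    hL σ₀ hσ₀ hσ₀1.le (u k) (hcont k) (hbdd k) (hdiv k) (hmild k) (hWM k)
  -- ### the limiting procedure
  obtain ⟨C, φ, aL, w, p, hφ, hsol, haLdiv, -, hpt, hE, hGb, hL2⟩ :=
    hN4 σ₀ hσ₀ le_rfl η hη (fun k => u k 0) u π hπ ha hWM hlay
  -- ### the final value of the limit vanishes ((4.4)), hence the limit vanishes on `(0, σ₀)`
  have hS : σ₀ ∈ Icc 0 σ₀ := ⟨hσ₀.le, le_rfl⟩
  have hwS : ∀ ψ : EuclideanSpace ℝ (Fin 3) → EuclideanSpace ℝ (Fin 3),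
      FunctionSpaces.IsTestFunctionOn (⊤ : Opens (EuclideanSpace ℝ (Fin 3))) ψ →
        ∫ x, ⟪w σ₀ x, ψ x⟫ = 0 := fun ψ hψ =>
    tendsto_nhds_unique (hpt σ₀ hS ψ hψ) ((hfinal ψ hψ).comp hφ.tendsto_atTop)
  have hfinalw : ∀ ψ : EuclideanSpace ℝ (Fin 3) → EuclideanSpace ℝ (Fin 3),
      FunctionSpaces.IsTestFunctionOn (⊤ : Opens (EuclideanSpace ℝ (Fin 3))) ψ →
        Tendsto (fun t => ∫ x, ⟪w t x, ψ x⟫) (𝓝[<] σ₀) (𝓝 0) := by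
    intro ψ hψ
    have h1 : Tendsto (fun t => ∫ x, ⟪w t x, ψ x⟫) (𝓝[Icc 0 σ₀] σ₀) (𝓝 (∫ x, ⟪w σ₀ x, ψ x⟫)) :=
      (hsol.weakContinuous ψ hψ) σ₀ hS
    rw [hwS ψ hψ] at h1
    have h2 : Tendsto (fun t => ∫ x, ⟪w t x, ψ x⟫) (𝓝[Ioo 0 σ₀] σ₀) (𝓝 0) :=
      h1.mono_left (nhdsWithin_mono _ Ioo_subset_Icc_self)
    rwa [nhdsWithin_Ioo_eq_nhdsLT hσ₀] at h2
  have hw0 : ∀ᵐ z ∂(volume.restrict (Ioo 0 σ₀ ×ˢ (univ : Set (EuclideanSpace ℝ (Fin 3))))),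
      w z.1 z.2 = 0 :=
    IsLocalLeraySolutionOn.ae_zero_of_final_vanishing_unit_anyDatum hσ₀ haLdiv
      hsol.isLocalLeraySolutionOn hfinalw
  -- ### the limit is (trivially) bounded near `(σ₀, 0)`: stability of regular points
  set r₀ : ℝ := Real.sqrt σ₀ / 2 with hr₀
  have hr₀pos : 0 < r₀ := by rw [hr₀]; positivity
  have hr₀sq : r₀ ^ 2 < σ₀ := by
    rw [hr₀, div_pow, Real.sq_sqrt hσ₀.le]; linarith
  have hcyl_sub : ∀ {r : ℝ}, r ^ 2 < σ₀ →
      parabolicCylinder r ((σ₀ : ℝ), (0 : EuclideanSpace ℝ (Fin 3))) ⊆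
        Ioo 0 σ₀ ×ˢ (univ : Set (EuclideanSpace ℝ (Fin 3))) := by
    intro r hr z hz
    rw [parabolicCylinder, mem_prod, mem_Ioo] at hz
    exact ⟨⟨by linarith [hz.1.1], hz.1.2⟩, mem_univ _⟩
  have hreg : ∃ r₀ : ℝ, 0 < r₀ ∧ r₀ ^ 2 < σ₀ ∧
      eLpNorm (uncurry w) ∞ (volume.restrict
        (parabolicCylinder r₀ ((σ₀ : ℝ), (0 : EuclideanSpace ℝ (Fin 3))))) < ∞ := by
    refine ⟨r₀, hr₀pos, hr₀sq, ?_⟩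
    have hae : (uncurry w) =ᵐ[volume.restrict
        (parabolicCylinder r₀ ((σ₀ : ℝ), (0 : EuclideanSpace ℝ (Fin 3))))] 0 := by
      have h1 := ae_restrict_of_ae_restrict_of_subset (hcyl_sub hr₀sq) hw0
      filter_upwards [h1] with z hz
      simpa [uncurry] using hz
    rw [eLpNorm_congr_ae hae, eLpNorm_zero]
    exact ENNReal.zero_lt_top
  obtain ⟨r₁, K₁, hr₁, hev⟩ := uniform_top_bound_of_bounded_limit_unit hσ₀ C
    (fun k => u (φ k) 0) (fun k => u (φ k)) (fun k => π (φ k)) aL w p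
    (fun k => (hπ (φ k)).isLocalLeraySolutionOn) hsol.isLocalLeraySolutionOn
    (fun k => hE (φ k)) (fun k => hGb (φ k)) hL2 0 hreg
  obtain ⟨N₀, hN₀⟩ := eventually_atTop.1 hev
  -- ### the window `(σ₀ - ρ², σ₀) × B(0, ρ)` and the pointwise bound by continuity
  set ρ : ℝ := min r₁ r₀ with hρ
  have hρpos : 0 < ρ := lt_min hr₁ hr₀pos
  have hρr₁ : ρ ≤ r₁ := min_le_left _ _
  have hρsq : ρ ^ 2 < σ₀ := lt_of_le_of_lt (pow_le_pow_left₀ hρpos.le (min_le_right _ _) 2) hr₀sq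
  set U : Set (ℝ × EuclideanSpace ℝ (Fin 3)) :=
    parabolicCylinder ρ ((σ₀ : ℝ), (0 : EuclideanSpace ℝ (Fin 3))) with hU
  have hUopen : IsOpen U := by
    rw [hU, parabolicCylinder]; exact isOpen_Ioo.prod isOpen_ball
  have hUsub : U ⊆ parabolicCylinder r₁ ((σ₀ : ℝ), (0 : EuclideanSpace ℝ (Fin 3))) := by
    intro z hz
    rw [hU, parabolicCylinder, mem_prod, mem_Ioo, mem_ball] at hz
    rw [parabolicCylinder, mem_prod, mem_Ioo, mem_ball]
    have h1 : ρ ^ 2 ≤ r₁ ^ 2 := pow_le_pow_left₀ hρpos.le hρr₁ 2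
    exact ⟨⟨by linarith [hz.1.1], hz.1.2⟩, lt_of_lt_of_le hz.2 hρr₁⟩
  have hUIcc : U ⊆ Icc 0 σ₀ ×ˢ (univ : Set (EuclideanSpace ℝ (Fin 3))) := fun z hz =>
    ⟨Ioo_subset_Icc_self (hcyl_sub hρsq hz).1, mem_univ _⟩
  refine ⟨fun j => φ (j + N₀), ρ, K₁, hφ.comp (fun a b hab => Nat.add_lt_add_right hab N₀), hρpos,
    fun j s hs y hy => ?_⟩
  have hbd : ∀ᵐ z ∂(volume.restrict U), ‖uncurry (u (φ (j + N₀))) z‖ ≤ K₁ :=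
    ae_restrict_of_ae_restrict_of_subset hUsub (hN₀ (j + N₀) (Nat.le_add_left _ _))
  have hcU : ContinuousOn (uncurry (u (φ (j + N₀)))) U := (hcont _).mono hUIcc
  have hmem : ((s, y) : ℝ × EuclideanSpace ℝ (Fin 3)) ∈ U := by
    rw [hU, parabolicCylinder, mem_prod]
    exact ⟨hs, hy⟩
  exact norm_le_of_ae_le_of_continuousOn hUopen hcU hbd (s, y) hmem

/-- **Albritton–Barker 2019, Theorem 4.1, from the local energy class of bounded mild solutions
with weak-`L³` data and their uniform initial layer** (the two properties of Barker–Seregin–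
Šverák's global weak `L^{3,∞}`-solutions used in the source's proof, hypotheses `hLE`, `hLayer`
of `blowdown_bound_of_localEnergy_of_layer`). [cite: AlbrittonBarker2019, Thm 4.1, proof (arXiv:1811.00502 §4 p. 9)] -/
theorem AlbrittonBarker2019_liouville_weakL3_backward_of_localEnergy_of_layer
    (hLE : ∀ (S : ℝ), 0 < S →
      ∀ u : ℝ → EuclideanSpace ℝ (Fin 3) → EuclideanSpace ℝ (Fin 3),
        ContinuousOn (uncurry u) (Icc 0 S ×ˢ univ) →
        (∃ C : ℝ, ∀ t ∈ Icc 0 S, ∀ x, ‖u t x‖ ≤ C) →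
        (∀ t ∈ Icc 0 S, IsWeaklyDivFree (u t)) →
        (∀ s t : ℝ, 0 ≤ s → s < t → t ≤ S → ∀ x,
          u t x = UnboundedOperators.heatExtension (u s) (t - s) x - oseenDuhamel 1 s u u t x) →
        FunctionSpaces.MemWeakLp (u 0) 3 volume →
        ∃ π : ℝ → EuclideanSpace ℝ (Fin 3) → ℝ, IsLocalEnergySolutionOn S 1 (u 0) u π)
    (hLayer : ∀ M : ℝ≥0, ∃ η : ℝ → ℝ≥0, Tendsto η (𝓝[>] 0) (𝓝 0) ∧
      ∀ (S : ℝ), 0 < S → S ≤ 1 →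
      ∀ u : ℝ → EuclideanSpace ℝ (Fin 3) → EuclideanSpace ℝ (Fin 3),
        ContinuousOn (uncurry u) (Icc 0 S ×ˢ univ) →
        (∃ C : ℝ, ∀ t ∈ Icc 0 S, ∀ x, ‖u t x‖ ≤ C) →
        (∀ t ∈ Icc 0 S, IsWeaklyDivFree (u t)) →
        (∀ s t : ℝ, 0 ≤ s → s < t → t ≤ S → ∀ x,
          u t x = UnboundedOperators.heatExtension (u s) (t - s) x - oseenDuhamel 1 s u u t x) →
        FunctionSpaces.eWeakLpPow (u 0) 3 volume ≤ M →
        ∀ t ∈ Ioo 0 S, ∀ x₀ : EuclideanSpace ℝ (Fin 3),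
          eLpNorm (u t - heatTest 1 (u 0) t) 2 (volume.restrict (ball x₀ 1)) ≤ η t) :
    AlbrittonBarker2019_liouville_weakL3_backward :=
  AlbrittonBarker2019_liouville_weakL3_backward_of_blowdown
    (blowdown_bound_of_localEnergy_of_layer hLE hLayer)

end Literature.Analysis.FluidPDE

end
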